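import Summits.Ventures.LatticeQCDFlow.Scaling.DoeblinHotAugmentation
import Summits.Ventures.LatticeQCDFlow.Scaling.DominatedStarTagMarginal

/-!
HONEST FRAMING: exact (Metropolis-corrected) sampling algorithms for lattice gauge theory; figures
of merit are autocorrelation/cost numbers at stated couplings and volumes; no continuum-physics
claim.

# DoeblinHotFreshness — WITH A PARTLY REFRESHED HUB, CLEAN COORDINATES STILL STAY EXACTLY DISTRIBUTED AND THE STALE SET
# STILL MOVES BY THE REGENERATION TAG CHAIN — WITH THE HOT WEIGHT `w₀` OF CHAPTER M REPLACED BY THE REFRESH WEIGHT `w_E`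
# (lean-2 GEN-27, ours)

Venture-side (OURS).  Cell `lqcd-flow` (pub-lqcd), unit `pub-lqcd-lean-2-g27`, 2026-08-27.  Doeblin-minorised hot
samplers, file 2.  Setting of `Scaling/DoeblinHotAugmentation`: hub list `e_r = (0, κ_r+1)` with maps `φ_r`, positive
unit-mass laws `μ_k`, swap fraction `t`, hot step = exact refresh with weight `w_E` (tag `0` erased) plus
`μ_k`-stationary single-site moves `M_k` with weights `w_k` at every level INCLUDING the hub (tags unchanged),
`w_E + Σ_k w_k = 1`; augmented chain `P̂` on `(configuration, stale set)` with chapter M's swap tags; the TAG CHAIN `Q`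
is chapter M's (`Scaling/RegenerationTagChain`) with `w₀ ↦ w_E`.  FRESH-EXCHANGEABILITY of a law `λ`:
`λ(z[j ↦ v], D)·μ_j(z_j) = λ(z, D)·μ_j(v)` for all `j ∉ D`.

## What is proved

* §1 **`dob_fresh_step`** — fresh-exchangeability is preserved by one step of `P̂` (the entry pieces are chapter M's
  `fresh_entry_piece`; the refresh piece is `fresh_hot_update`; EVERY move piece, the hub's included, is
  `fresh_cold_update`, which only uses stationarity); **`dob_fresh_lawAt_of`** — from any fresh initial augmented law
  `Λ₀` it holds at all times.
* §2 **`dob_tag_step`** — for a fresh `λ`: `Σ_{z'} (λP̂)(z', D') = Σ_D (Σ_z λ(z,D))·Q(D,D')`;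
  **`dob_lawAt_snd_of`** — the tag marginal of `Λ₀P̂ⁿ` is `ν₀Qⁿ`, `ν₀(D) = Σ_z Λ₀(z, D)`.

Reading (no numerics implied): a hot move that is merely stationary neither cleans nor dirties anything — it is
book-kept exactly like a cold update — so the only change to chapter M's tag chain is the rate at which the hub tag
is erased: `(1−t)·w_E` instead of `(1−t)·w₀`.  NOT CLAIMED here: the minorisation and the ceilings (the sequels
`Scaling/DoeblinHotMinorization`, `Scaling/DoeblinHotMixingCeiling`).  Literature grade (cell rule): OWN CONSTRUCTION;
nothing cited as a fact; no new bib keys.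
-/

noncomputable section

open Finset Function
open Literature.Probability.MarkovChains

namespace Summit.Ventures.LatticeQCDFlow.Scaling

variable {S : Type*} [Fintype S] [DecidableEq S] {K m : ℕ} {μ : Fin (K + 1) → S → ℝ} {M E : Fin (K + 1) → S → S → ℝ}
  {w : Fin (K + 1) → ℝ} {t wE p q : ℝ}

section Fresh
variable (κ : Fin m → Fin K) (φ : Fin m → Equiv.Perm S)

/-! ## §1 Fresh-exchangeability is preserved -/

/-- **FRESH-EXCHANGEABILITY IS PRESERVED BY ONE STEP OF `P̂`:** exact samplers `E_k(u,·) = μ_k`, `μ_k`-stationary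
moves `M_k` at every level (the hub included), positive laws; if `λ(z[j ↦ v], D)·μ_j(z_j) = λ(z, D)·μ_j(v)` for all
`j ∉ D`, the same holds for `λP̂`. [ours] -/
theorem dob_fresh_step (hμ : ∀ k x, 0 < μ k x) (hE : ∀ k u v, E k u v = μ k v)
    (hstat : ∀ (k : Fin (K + 1)) (v : S), ∑ u, μ k u * M k u v = μ k v)
    {α : Fin m → (Fin (K + 1) → S) → ℝ}
    (hα : ∀ r z, α r z = min 1 (tensorFun μ (edgeFlowSwap (φ r) 0 (κ r).succ z) / tensorFun μ z))
    {β : Fin m → (Fin (K + 1) → S) → ℝ} (hβ : ∀ r z, β r z = p * μ (κ r).succ (φ r (z 0)) / μ 0 (z 0))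
    {β' : Fin m → (Fin (K + 1) → S) → ℝ}
    (hβ' : ∀ r z, β' r z = q * μ 0 ((φ r).symm (z (κ r).succ)) / μ (κ r).succ (z (κ r).succ))
    {γ : Fin m → (Fin (K + 1) → S) × Finset (Fin (K + 1)) → ℝ}
    (hγ : ∀ r a, γ r a = if (0 : Fin (K + 1)) ∉ a.2 then (if (κ r).succ ∉ a.2 then α r a.1 else β r a.1)
      else (if (κ r).succ ∉ a.2 then β' r a.1 else 0))
    {Bset : Fin m → Finset (Fin (K + 1)) → Finset (Fin (K + 1))}
    (hB : ∀ r D, Bset r D = if (0 : Fin (K + 1)) ∉ D ∧ (κ r).succ ∉ D then D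
      else insert (0 : Fin (K + 1)) (insert (κ r).succ D))
    {Ph : (Fin (K + 1) → S) × Finset (Fin (K + 1)) → (Fin (K + 1) → S) × Finset (Fin (K + 1)) → ℝ}
    (hPh : ∀ a b, Ph a b = ∑ r : Fin m, t / m *
        (γ r a * (if b.1 = edgeFlowSwap (φ r) 0 (κ r).succ a.1 ∧ b.2 = a.2.image (Equiv.swap (0 : Fin (K + 1)) (κ r).succ)
            then (1 : ℝ) else 0)
          + (α r a.1 - γ r a) * (if b.1 = edgeFlowSwap (φ r) 0 (κ r).succ a.1 ∧ b.2 = Bset r a.2 then (1 : ℝ) else 0)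
          + (1 - α r a.1) * (if b.1 = a.1 ∧ b.2 = Bset r a.2 then (1 : ℝ) else 0))
      + (1 - t) * (wE * (coordKernel E 0 a.1 b.1 * (if b.2 = a.2.erase 0 then (1 : ℝ) else 0))
          + ∑ k : Fin (K + 1), w k * (coordKernel M k a.1 b.1 * (if b.2 = a.2 then (1 : ℝ) else 0))))
    {lam : (Fin (K + 1) → S) × Finset (Fin (K + 1)) → ℝ}
    (hlam : ∀ (z : Fin (K + 1) → S) (D : Finset (Fin (K + 1))) (j : Fin (K + 1)) (v : S), j ∉ D →
      lam (update z j v, D) * μ j (z j) = lam (z, D) * μ j v) :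
    ∀ (z : Fin (K + 1) → S) (D : Finset (Fin (K + 1))) (j : Fin (K + 1)) (v : S), j ∉ D →
      stepLaw Ph lam (update z j v, D) * μ j (z j) = stepLaw Ph lam (z, D) * μ j v := by
  intro z' D' j v hj
  rw [dob_stepLaw_apply κ φ hPh lam (update z' j v) D', dob_stepLaw_apply κ φ hPh lam z' D', add_mul, add_mul,
    Finset.sum_mul, Finset.sum_mul]
  congr 1
  · refine sum_congr rfl fun r _ => ?_
    rw [mul_assoc, mul_assoc, Finset.sum_mul, Finset.sum_mul]
    congr 1
    refine sum_congr rfl fun D _ => ?_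
    exact fresh_entry_piece κ φ hμ hα hβ hβ' hγ hB (fun z i u hi => hlam z D i u hi) r D' hj z' v
  · rw [mul_assoc, mul_assoc]
    congr 1
    rw [add_mul, add_mul]
    congr 1
    · -- the refresh piece: source tags `D` with `D ∖ {0} = D'`, so `j ∉ D` unless `j = 0`
      rw [mul_assoc, mul_assoc]
      congr 1
      rw [Finset.sum_mul, Finset.sum_mul]
      refine sum_congr rfl fun D hD => ?_
      have hD' := (Finset.mem_filter.mp hD).2
      have hjD : j ≠ 0 → j ∉ D := fun hj0 h => hj (hD' ▸ Finset.mem_erase.mpr ⟨hj0, h⟩)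
      simp_rw [hE]
      exact fresh_hot_update (fun hj0 z u => hlam z D j u (hjD hj0)) z' v
    · -- the move pieces: stationarity at every level, the hub included
      rw [Finset.sum_mul, Finset.sum_mul]
      refine sum_congr rfl fun k _ => ?_
      rw [mul_assoc, mul_assoc]
      congr 1
      exact fresh_cold_update hμ (hstat k) (fun z i u hi => hlam z D' i u hi) z' hj v

/-- **FRESHNESS PROPAGATES FROM ANY FRESH INITIAL LAW** (exact refresh, stationary moves at every level). [ours] -/
theorem dob_fresh_lawAt_of (hμ : ∀ k x, 0 < μ k x) (hE : ∀ k u v, E k u v = μ k v)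
    (hstat : ∀ (k : Fin (K + 1)) (v : S), ∑ u, μ k u * M k u v = μ k v)
    {α : Fin m → (Fin (K + 1) → S) → ℝ}
    (hα : ∀ r z, α r z = min 1 (tensorFun μ (edgeFlowSwap (φ r) 0 (κ r).succ z) / tensorFun μ z))
    {β : Fin m → (Fin (K + 1) → S) → ℝ} (hβ : ∀ r z, β r z = p * μ (κ r).succ (φ r (z 0)) / μ 0 (z 0))
    {β' : Fin m → (Fin (K + 1) → S) → ℝ}
    (hβ' : ∀ r z, β' r z = q * μ 0 ((φ r).symm (z (κ r).succ)) / μ (κ r).succ (z (κ r).succ))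
    {γ : Fin m → (Fin (K + 1) → S) × Finset (Fin (K + 1)) → ℝ}
    (hγ : ∀ r a, γ r a = if (0 : Fin (K + 1)) ∉ a.2 then (if (κ r).succ ∉ a.2 then α r a.1 else β r a.1)
      else (if (κ r).succ ∉ a.2 then β' r a.1 else 0))
    {Bset : Fin m → Finset (Fin (K + 1)) → Finset (Fin (K + 1))}
    (hB : ∀ r D, Bset r D = if (0 : Fin (K + 1)) ∉ D ∧ (κ r).succ ∉ D then D
      else insert (0 : Fin (K + 1)) (insert (κ r).succ D))
    {Ph : (Fin (K + 1) → S) × Finset (Fin (K + 1)) → (Fin (K + 1) → S) × Finset (Fin (K + 1)) → ℝ}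
    (hPh : ∀ a b, Ph a b = ∑ r : Fin m, t / m *
        (γ r a * (if b.1 = edgeFlowSwap (φ r) 0 (κ r).succ a.1 ∧ b.2 = a.2.image (Equiv.swap (0 : Fin (K + 1)) (κ r).succ)
            then (1 : ℝ) else 0)
          + (α r a.1 - γ r a) * (if b.1 = edgeFlowSwap (φ r) 0 (κ r).succ a.1 ∧ b.2 = Bset r a.2 then (1 : ℝ) else 0)
          + (1 - α r a.1) * (if b.1 = a.1 ∧ b.2 = Bset r a.2 then (1 : ℝ) else 0))
      + (1 - t) * (wE * (coordKernel E 0 a.1 b.1 * (if b.2 = a.2.erase 0 then (1 : ℝ) else 0))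
          + ∑ k : Fin (K + 1), w k * (coordKernel M k a.1 b.1 * (if b.2 = a.2 then (1 : ℝ) else 0))))
    {Λ₀ : (Fin (K + 1) → S) × Finset (Fin (K + 1)) → ℝ}
    (hfresh : ∀ (z : Fin (K + 1) → S) (D : Finset (Fin (K + 1))) (j : Fin (K + 1)) (v : S), j ∉ D →
      Λ₀ (update z j v, D) * μ j (z j) = Λ₀ (z, D) * μ j v)
    (n : ℕ) :
    ∀ (z : Fin (K + 1) → S) (D : Finset (Fin (K + 1))) (j : Fin (K + 1)) (v : S), j ∉ D →
      lawAt Ph Λ₀ n (update z j v, D) * μ j (z j) = lawAt Ph Λ₀ n (z, D) * μ j v := by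
  induction n with
  | zero => intro z D j v hj; rw [lawAt_zero]; exact hfresh z D j v hj
  | succ n ih =>
    intro z D j v hj
    rw [lawAt_succ]
    exact dob_fresh_step κ φ hμ hE hstat hα hβ hβ' hγ hB hPh ih z D j v hj

/-! ## §2 The tag marginal of a fresh law moves by the tag chain with hot weight `w_E` -/

/-- **THE TAG MARGINAL OF A FRESH LAW MOVES BY THE REGENERATION TAG CHAIN WITH HOT WEIGHT `w_E`:**
`Σ_{z'} (λP̂)(z', D') = Σ_D (Σ_z λ(z,D))·Q(D,D')` (`w_E + Σ_k w_k = 1`, `M_k` row-stochastic, unit-mass laws). [ours] -/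
theorem dob_tag_step (hμ : ∀ k x, 0 < μ k x) (hμ1 : ∀ k, ∑ u, μ k u = 1) (hM : ∀ k, IsRowStochastic (M k))
    (hE : ∀ k u v, E k u v = μ k v) (hw1 : wE + ∑ k, w k = 1)
    {α : Fin m → (Fin (K + 1) → S) → ℝ}
    {β : Fin m → (Fin (K + 1) → S) → ℝ} (hβ : ∀ r z, β r z = p * μ (κ r).succ (φ r (z 0)) / μ 0 (z 0))
    {β' : Fin m → (Fin (K + 1) → S) → ℝ}
    (hβ' : ∀ r z, β' r z = q * μ 0 ((φ r).symm (z (κ r).succ)) / μ (κ r).succ (z (κ r).succ))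
    {γ : Fin m → (Fin (K + 1) → S) × Finset (Fin (K + 1)) → ℝ}
    (hγ : ∀ r a, γ r a = if (0 : Fin (K + 1)) ∉ a.2 then (if (κ r).succ ∉ a.2 then α r a.1 else β r a.1)
      else (if (κ r).succ ∉ a.2 then β' r a.1 else 0))
    {gbar : Fin m → Finset (Fin (K + 1)) → ℝ}
    (hg : ∀ r D, gbar r D = if (0 : Fin (K + 1)) ∉ D then (if (κ r).succ ∉ D then (1 : ℝ) else p)
      else (if (κ r).succ ∉ D then q else 0))
    {Bset : Fin m → Finset (Fin (K + 1)) → Finset (Fin (K + 1))}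
    (hB : ∀ r D, Bset r D = if (0 : Fin (K + 1)) ∉ D ∧ (κ r).succ ∉ D then D
      else insert (0 : Fin (K + 1)) (insert (κ r).succ D))
    {Ph : (Fin (K + 1) → S) × Finset (Fin (K + 1)) → (Fin (K + 1) → S) × Finset (Fin (K + 1)) → ℝ}
    (hPh : ∀ a b, Ph a b = ∑ r : Fin m, t / m *
        (γ r a * (if b.1 = edgeFlowSwap (φ r) 0 (κ r).succ a.1 ∧ b.2 = a.2.image (Equiv.swap (0 : Fin (K + 1)) (κ r).succ)
            then (1 : ℝ) else 0)
          + (α r a.1 - γ r a) * (if b.1 = edgeFlowSwap (φ r) 0 (κ r).succ a.1 ∧ b.2 = Bset r a.2 then (1 : ℝ) else 0)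
          + (1 - α r a.1) * (if b.1 = a.1 ∧ b.2 = Bset r a.2 then (1 : ℝ) else 0))
      + (1 - t) * (wE * (coordKernel E 0 a.1 b.1 * (if b.2 = a.2.erase 0 then (1 : ℝ) else 0))
          + ∑ k : Fin (K + 1), w k * (coordKernel M k a.1 b.1 * (if b.2 = a.2 then (1 : ℝ) else 0))))
    {Q : Finset (Fin (K + 1)) → Finset (Fin (K + 1)) → ℝ}
    (hQ : ∀ D D', Q D D' = ∑ r : Fin m, t / m *
        (gbar r D * (if D' = D.image (Equiv.swap (0 : Fin (K + 1)) (κ r).succ) then (1 : ℝ) else 0)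
          + (1 - gbar r D) * (if D' = Bset r D then (1 : ℝ) else 0))
      + (1 - t) * (wE * (if D' = D.erase 0 then (1 : ℝ) else 0) + (1 - wE) * (if D' = D then (1 : ℝ) else 0)))
    {lam : (Fin (K + 1) → S) × Finset (Fin (K + 1)) → ℝ}
    (hlam : ∀ (z : Fin (K + 1) → S) (D : Finset (Fin (K + 1))) (j : Fin (K + 1)) (v : S), j ∉ D →
      lam (update z j v, D) * μ j (z j) = lam (z, D) * μ j v)
    (D' : Finset (Fin (K + 1))) :
    ∑ z' : Fin (K + 1) → S, stepLaw Ph lam (z', D') = ∑ D : Finset (Fin (K + 1)), (∑ z, lam (z, D)) * Q D D' := by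
  -- row sums of `P̂` over the configuration: the tag kernel given `(z, D)`
  have hErs := exactSampler_isRowStochastic hμ hμ1 hE
  have hone : ∀ (N : Fin (K + 1) → S → S → ℝ) (k : Fin (K + 1)), IsRowStochastic (N k) →
      ∀ z : Fin (K + 1) → S, ∑ z' : Fin (K + 1) → S, coordKernel N k z z' = 1 := by
    intro N k hN z
    have h := sum_coordKernel_mul N k z (fun _ => (1 : ℝ))
    simp only [mul_one] at h
    rw [h, hN.2]
  have honeE : ∀ z : Fin (K + 1) → S, ∑ z' : Fin (K + 1) → S, coordKernel E 0 z z' = 1 := hone E 0 (hErs 0)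
  have honeM : ∀ (k : Fin (K + 1)) (z : Fin (K + 1) → S), ∑ z' : Fin (K + 1) → S, coordKernel M k z z' = 1 :=
    fun k => hone M k (hM k)
  have hw0' : ∑ k, w k = 1 - wE := by linarith
  -- the update part of the row sums (stated with the tags as plain parameters, closed by `exact` up to unfolding)
  have hupd : ∀ (z : Fin (K + 1) → S) (D : Finset (Fin (K + 1))),
      ∑ z' : Fin (K + 1) → S, (wE * (coordKernel E 0 z z' * (if D' = D.erase 0 then (1 : ℝ) else 0))
        + ∑ k : Fin (K + 1), w k * (coordKernel M k z z' * (if D' = D then (1 : ℝ) else 0)))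
      = wE * (if D' = D.erase 0 then (1 : ℝ) else 0) + (1 - wE) * (if D' = D then (1 : ℝ) else 0) := by
    intro z D
    rw [Finset.sum_add_distrib, ← Finset.mul_sum, ← Finset.sum_mul, honeE, one_mul, Finset.sum_comm]
    simp_rw [← Finset.mul_sum, ← Finset.sum_mul, honeM, one_mul]
    rw [← Finset.sum_mul, hw0']
  have hrow : ∀ (z : Fin (K + 1) → S) (D : Finset (Fin (K + 1))), ∑ z' : Fin (K + 1) → S, Ph (z, D) (z', D')
      = ∑ r : Fin m, t / m * (γ r (z, D) * ((if D' = D.image (Equiv.swap (0 : Fin (K + 1)) (κ r).succ) then (1 : ℝ) else 0)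
            - (if D' = Bset r D then (1 : ℝ) else 0)) + (if D' = Bset r D then (1 : ℝ) else 0))
        + (1 - t) * (wE * (if D' = D.erase 0 then (1 : ℝ) else 0) + (1 - wE) * (if D' = D then (1 : ℝ) else 0)) := by
    intro z D
    simp_rw [hPh]
    rw [Finset.sum_add_distrib]
    congr 1
    · rw [Finset.sum_comm]
      refine sum_congr rfl fun r _ => ?_
      rw [← Finset.mul_sum, Finset.sum_add_distrib, Finset.sum_add_distrib, ← Finset.mul_sum, ← Finset.mul_sum,
        ← Finset.mul_sum]
      simp only [ite_and, Finset.sum_ite_eq', Finset.mem_univ, if_true]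
      ring
    · rw [← Finset.mul_sum]
      congr 1
      exact hupd z D
  -- integrate `λ` against the row sums, tag class by tag class
  unfold stepLaw
  rw [Finset.sum_comm]
  simp_rw [← Finset.mul_sum]
  rw [Fintype.sum_prod_type]
  simp_rw [hrow]
  rw [Finset.sum_comm]
  refine sum_congr rfl fun D _ => ?_
  have hsplit : ∀ z : Fin (K + 1) → S, lam (z, D) * (∑ r : Fin m, t / m * (γ r (z, D)
        * ((if D' = D.image (Equiv.swap (0 : Fin (K + 1)) (κ r).succ) then (1 : ℝ) else 0)
            - (if D' = Bset r D then (1 : ℝ) else 0)) + (if D' = Bset r D then (1 : ℝ) else 0))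
        + (1 - t) * (wE * (if D' = D.erase 0 then (1 : ℝ) else 0) + (1 - wE) * (if D' = D then (1 : ℝ) else 0)))
      = (∑ r : Fin m, (t / m * ((if D' = D.image (Equiv.swap (0 : Fin (K + 1)) (κ r).succ) then (1 : ℝ) else 0)
            - (if D' = Bset r D then (1 : ℝ) else 0)) * (lam (z, D) * γ r (z, D))
          + t / m * (if D' = Bset r D then (1 : ℝ) else 0) * lam (z, D)))
        + (1 - t) * (wE * (if D' = D.erase 0 then (1 : ℝ) else 0) + (1 - wE) * (if D' = D then (1 : ℝ) else 0))
          * lam (z, D) := by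
    intro z
    rw [mul_add, Finset.mul_sum]
    congr 1
    · exact sum_congr rfl fun r _ => by ring
    · ring
  rw [sum_congr rfl (fun z _ => hsplit z), Finset.sum_add_distrib]
  have part2 : ∑ z : Fin (K + 1) → S, (1 - t) * (wE * (if D' = D.erase 0 then (1 : ℝ) else 0)
        + (1 - wE) * (if D' = D then (1 : ℝ) else 0)) * lam (z, D)
      = (1 - t) * (wE * (if D' = D.erase 0 then (1 : ℝ) else 0) + (1 - wE) * (if D' = D then (1 : ℝ) else 0))
        * ∑ z : Fin (K + 1) → S, lam (z, D) := by rw [Finset.mul_sum]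
  have part1 : ∑ z : Fin (K + 1) → S, ∑ r : Fin m,
        (t / m * ((if D' = D.image (Equiv.swap (0 : Fin (K + 1)) (κ r).succ) then (1 : ℝ) else 0)
            - (if D' = Bset r D then (1 : ℝ) else 0)) * (lam (z, D) * γ r (z, D))
          + t / m * (if D' = Bset r D then (1 : ℝ) else 0) * lam (z, D))
      = ∑ r : Fin m, (t / m * ((if D' = D.image (Equiv.swap (0 : Fin (K + 1)) (κ r).succ) then (1 : ℝ) else 0)
            - (if D' = Bset r D then (1 : ℝ) else 0)) * ∑ z, lam (z, D) * γ r (z, D)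
          + t / m * (if D' = Bset r D then (1 : ℝ) else 0) * ∑ z, lam (z, D)) := by
    rw [Finset.sum_comm]
    refine sum_congr rfl fun r _ => ?_
    rw [Finset.sum_add_distrib, ← Finset.mul_sum, ← Finset.mul_sum]
  rw [part1, part2]
  have hgw := fun r => fresh_goodWeight_sum κ φ hμ hμ1 hβ hβ' hγ hg hB (fun z j v hj => hlam z D j v hj) r D'
  rw [sum_congr rfl (fun r _ => show t / m * ((if D' = D.image (Equiv.swap (0 : Fin (K + 1)) (κ r).succ) then (1 : ℝ)
        else 0) - (if D' = Bset r D then (1 : ℝ) else 0)) * ∑ z, lam (z, D) * γ r (z, D)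
        + t / m * (if D' = Bset r D then (1 : ℝ) else 0) * ∑ z, lam (z, D)
      = (∑ z, lam (z, D)) * (t / m * (gbar r D * (if D' = D.image (Equiv.swap (0 : Fin (K + 1)) (κ r).succ) then (1 : ℝ)
        else 0) + (1 - gbar r D) * (if D' = Bset r D then (1 : ℝ) else 0))) by
      have h := hgw r
      calc t / m * ((if D' = D.image (Equiv.swap (0 : Fin (K + 1)) (κ r).succ) then (1 : ℝ) else 0)
              - (if D' = Bset r D then (1 : ℝ) else 0)) * ∑ z, lam (z, D) * γ r (z, D)
            + t / m * (if D' = Bset r D then (1 : ℝ) else 0) * ∑ z, lam (z, D)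
          = t / m * ((∑ z, lam (z, D) * γ r (z, D))
              * ((if D' = D.image (Equiv.swap (0 : Fin (K + 1)) (κ r).succ) then (1 : ℝ) else 0)
                - (if D' = Bset r D then (1 : ℝ) else 0)))
            + t / m * (if D' = Bset r D then (1 : ℝ) else 0) * ∑ z, lam (z, D) := by ring
        _ = t / m * (gbar r D * (∑ z, lam (z, D))
              * ((if D' = D.image (Equiv.swap (0 : Fin (K + 1)) (κ r).succ) then (1 : ℝ) else 0)
                - (if D' = Bset r D then (1 : ℝ) else 0)))
            + t / m * (if D' = Bset r D then (1 : ℝ) else 0) * ∑ z, lam (z, D) := by rw [h]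
        _ = _ := by ring),
    ← Finset.mul_sum, hQ]
  ring

/-- **THE TAG MARGINAL FROM A FRESH INITIAL LAW: `Σ_z Λ_n(z, D) = (ν₀Qⁿ)(D)`**, `ν₀(D) = Σ_z Λ₀(z, D)`, with `Q` the
regeneration tag chain of hot weight `w_E`. [ours] -/
theorem dob_lawAt_snd_of (hμ : ∀ k x, 0 < μ k x) (hμ1 : ∀ k, ∑ u, μ k u = 1) (hM : ∀ k, IsRowStochastic (M k))
    (hE : ∀ k u v, E k u v = μ k v) (hstat : ∀ (k : Fin (K + 1)) (v : S), ∑ u, μ k u * M k u v = μ k v)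
    (hw1 : wE + ∑ k, w k = 1)
    {α : Fin m → (Fin (K + 1) → S) → ℝ}
    (hα : ∀ r z, α r z = min 1 (tensorFun μ (edgeFlowSwap (φ r) 0 (κ r).succ z) / tensorFun μ z))
    {β : Fin m → (Fin (K + 1) → S) → ℝ} (hβ : ∀ r z, β r z = p * μ (κ r).succ (φ r (z 0)) / μ 0 (z 0))
    {β' : Fin m → (Fin (K + 1) → S) → ℝ}
    (hβ' : ∀ r z, β' r z = q * μ 0 ((φ r).symm (z (κ r).succ)) / μ (κ r).succ (z (κ r).succ))
    {γ : Fin m → (Fin (K + 1) → S) × Finset (Fin (K + 1)) → ℝ}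
    (hγ : ∀ r a, γ r a = if (0 : Fin (K + 1)) ∉ a.2 then (if (κ r).succ ∉ a.2 then α r a.1 else β r a.1)
      else (if (κ r).succ ∉ a.2 then β' r a.1 else 0))
    {gbar : Fin m → Finset (Fin (K + 1)) → ℝ}
    (hg : ∀ r D, gbar r D = if (0 : Fin (K + 1)) ∉ D then (if (κ r).succ ∉ D then (1 : ℝ) else p)
      else (if (κ r).succ ∉ D then q else 0))
    {Bset : Fin m → Finset (Fin (K + 1)) → Finset (Fin (K + 1))}
    (hB : ∀ r D, Bset r D = if (0 : Fin (K + 1)) ∉ D ∧ (κ r).succ ∉ D then D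
      else insert (0 : Fin (K + 1)) (insert (κ r).succ D))
    {Ph : (Fin (K + 1) → S) × Finset (Fin (K + 1)) → (Fin (K + 1) → S) × Finset (Fin (K + 1)) → ℝ}
    (hPh : ∀ a b, Ph a b = ∑ r : Fin m, t / m *
        (γ r a * (if b.1 = edgeFlowSwap (φ r) 0 (κ r).succ a.1 ∧ b.2 = a.2.image (Equiv.swap (0 : Fin (K + 1)) (κ r).succ)
            then (1 : ℝ) else 0)
          + (α r a.1 - γ r a) * (if b.1 = edgeFlowSwap (φ r) 0 (κ r).succ a.1 ∧ b.2 = Bset r a.2 then (1 : ℝ) else 0)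
          + (1 - α r a.1) * (if b.1 = a.1 ∧ b.2 = Bset r a.2 then (1 : ℝ) else 0))
      + (1 - t) * (wE * (coordKernel E 0 a.1 b.1 * (if b.2 = a.2.erase 0 then (1 : ℝ) else 0))
          + ∑ k : Fin (K + 1), w k * (coordKernel M k a.1 b.1 * (if b.2 = a.2 then (1 : ℝ) else 0))))
    {Q : Finset (Fin (K + 1)) → Finset (Fin (K + 1)) → ℝ}
    (hQ : ∀ D D', Q D D' = ∑ r : Fin m, t / m *
        (gbar r D * (if D' = D.image (Equiv.swap (0 : Fin (K + 1)) (κ r).succ) then (1 : ℝ) else 0)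
          + (1 - gbar r D) * (if D' = Bset r D then (1 : ℝ) else 0))
      + (1 - t) * (wE * (if D' = D.erase 0 then (1 : ℝ) else 0) + (1 - wE) * (if D' = D then (1 : ℝ) else 0)))
    {Λ₀ : (Fin (K + 1) → S) × Finset (Fin (K + 1)) → ℝ}
    (hfresh : ∀ (z : Fin (K + 1) → S) (D : Finset (Fin (K + 1))) (j : Fin (K + 1)) (v : S), j ∉ D →
      Λ₀ (update z j v, D) * μ j (z j) = Λ₀ (z, D) * μ j v)
    (n : ℕ) (D : Finset (Fin (K + 1))) :
    ∑ z : Fin (K + 1) → S, lawAt Ph Λ₀ n (z, D) = lawAt Q (fun D' => ∑ z : Fin (K + 1) → S, Λ₀ (z, D')) n D := by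
  induction n generalizing D with
  | zero => rw [lawAt_zero, lawAt_zero]
  | succ n ih =>
    rw [lawAt_succ, lawAt_succ,
      dob_tag_step κ φ hμ hμ1 hM hE hw1 hβ hβ' hγ hg hB hPh hQ
        (dob_fresh_lawAt_of κ φ hμ hE hstat hα hβ hβ' hγ hB hPh hfresh n) D]
    unfold stepLaw
    exact sum_congr rfl fun D₁ _ => by rw [ih D₁]

end Fresh

end Summit.Ventures.LatticeQCDFlow.Scaling

end
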